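import Literature.NumberTheory.Transcendental.KaehlerIdentityAssemblyProofs

/-!
# The Kähler identity `[∂̄*, L] = i∂` in the edge degree `n - 1`

Trunk **T-KAEHLER** (`NumberTheory/Transcendental`), theorems-only sequel of
`KaehlerIdentityAssemblyProofs.lean`, serving the named fact
`Literature.NumberTheory.Transcendental.cHodgeLaplacian_eq_two_smul_dolbeaultLaplacian_of_isManifold_complex`
of `KaehlerHodge.lean` (the Kähler identity `Δ_d = 2Δ_∂̄`, Voisin (2002), Thm. 6.7).

`KaehlerIdentityAssemblyProofs.lean` proves Voisin's first-order Kähler identity in `L`-form,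
`P α := ∂̄*(Lα) - L(∂̄*α) - i∂α = 0` (`kaehlerP_apply_eq_zero`, Voisin (2002), §6.1.1, Prop. 6.5
with Lemma 6.6, by the osculation argument of Prop. 3.14), for smooth forms `α` of degree `k + 1`
with `k + 3 ≤ n` (so that `⋆` is available on the `(k+3)`-form `Lα`), and on functions
(`kaehlerP_apply_eq_zero_zero`). The passage to the `Λ`-form `[Λ, ∂̄] = -i∂*`, `[Λ, ∂] = i∂̄*`
(`KaehlerIdentityLambdaProofs.lean`, by `⋆`-conjugation) needs the identity in **every** degree,
and on `1`-forms the `Λ`-identities are the `⋆`-conjugates of `P = 0` in the *edge degree*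
`n - 1`, where `Lα` is an `(n+1)`-form, hence `0`, and the identity reads

  `P₁ α := -L(∂̄*α) - i∂α = 0`   (`α` smooth of degree `k + 1`, `(k + 1) + 1 = n`).

This file proves it (`kaehlerP_apply_eq_zero_one`) by re-running Voisin's osculation proof with the
bricks of the sibling files, the only new ingredient being the symbol computation in that degree:

* `symbol_dolbeaultBarAdjoint_lefschetz_one_of` — Lemma 6.6 in symbol form, operator version, edge
  degree: `L₁(⋆_ℂ(ξ ∧ ⋆_ℂ β)) - i(ξ ∧ β) = 0` whenever `L₂ β = 0` (pointwise linear algebra, from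
  `cHodgeStar_wedgeOne_cHodgeStar`, `curryLeftC_lefschetz_eq_of`, `innerSL_J_dual_re_add` of
  `KaehlerSymbolIdentity(Op)Proofs.lean`); `symbol_identity_pt_one` — the same at a point of `M`,
  where `L β = 0` because forms of degree `n + 1` on an `n`-dimensional tangent space vanish
  (`calt_tangentSpace_eq_zero_of_lt`);
* `kaehlerP_fun_smul_one` (`P₁` is `C^∞`-linear), `kaehlerP_congr_of_eventuallyEq_one` (local),
  `kaehlerP_sum_one`, `kaehlerP_sum_fun_smul_eq_zero_one` (frame reduction),
  `kaehlerP_testForm_apply_eq_zero_one` (`P₁ Θ = 0` at the centre for the osculating test forms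
  `Θ_{f,η}` of `KaehlerOsculatingTestFormsProofs.lean`: `∂̄*Θ(x₀) = 0 = ∂Θ(x₀)`);
* `kaehlerP_apply_eq_zero_one` — the assembly, word for word that of `kaehlerP_apply_eq_zero`.

No definitions (local notations only, those of the sibling files); no named fact is introduced.

## References

* C. Voisin, *Hodge Theory and Complex Algebraic Geometry I* (2002), Prop. 3.14; §6.1.1,
  Prop. 6.5, Lemma 6.6 (pp. 139–140). [Voisin2002]
* D. Huybrechts, *Complex Geometry* (2005), Prop. 1.2.26, Prop. 3.1.12. [Huybrechts2005]
-/

noncomputable section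

open scoped Manifold ContDiff Topology RealInnerProductSpace
open Set Finset Function Bundle Module Filter ContinuousAlternatingMap Complex
open Literature.Analysis.OperatorTheory Literature.Analysis.Complex Literature.LinearAlgebra.Alternating
open Literature.Geometry.Kaehler

namespace Literature.NumberTheory.Transcendental

set_option quotPrecheck false

/-- Complexification of a real covector. -/
local notation "𝔠₁" ξ:max => ContinuousLinearMap.comp Complex.ofRealCLM ξ

/-- The complexified Hodge star at a point. -/
local notation "⋆ℂ[" o ", " h "]" η:max =>
  ContinuousLinearMap.compContinuousAlternatingMap Complex.ofRealCLM
      (hodgeStar o h (ContinuousLinearMap.compContinuousAlternatingMap Complex.reCLM η)) +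
    Complex.I • ContinuousLinearMap.compContinuousAlternatingMap Complex.ofRealCLM
      (hodgeStar o h (ContinuousLinearMap.compContinuousAlternatingMap Complex.imCLM η))

/-- The complex contraction `ι_{u₁ + i u₂} η = u₁ ⌟ η + i (u₂ ⌟ η)`. -/
local notation "ιℂ[" u₁ ", " u₂ "]" η:max =>
  ContinuousAlternatingMap.curryLeft η u₁ + Complex.I • ContinuousAlternatingMap.curryLeft η u₂

set_option hygiene false in
/-- The covector family `θ_B v = ½ B(i v, ·)` of a real bilinear form `B` on the model space. -/
local notation "θE[" B "]" => (2⁻¹ : ℝ) • ContinuousLinearMap.comp B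
  ((Complex.I • ContinuousLinearMap.id ℂ E).restrictScalars ℝ)

set_option hygiene false in
/-- The canonical family `v ↦ θ_B v ∧ η` of the model Lefschetz operator. -/
local notation "LfamE[" B "]" η:max =>
  ContinuousLinearMap.comp (ContinuousAlternatingMap.alternatizeUncurryFinCLM ℝ E ℂ)
    (ContinuousLinearMap.comp (ContinuousLinearMap.flip
      (ContinuousLinearMap.smulRightL ℝ E (E [⋀^Fin _]→L[ℝ] ℂ)) η) (θE[B]))

set_option hygiene false in
/-- The model Lefschetz operator `L_B η`. -/
local notation "LopE[" B "]" η:max =>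
  ContinuousAlternatingMap.alternatizeUncurryFin (𝕜 := ℝ) (E := E) (F := ℂ) (LfamE[B] η)

set_option hygiene false in
/-- The Lefschetz operator of the family `G` on forms on `M`. -/
local notation "Lform[" G "]" β:max =>
  @id (MForm 𝓘(ℝ, E) M ℂ (_ + 1 + 1)) (fun x ↦ (LopE[G x] (β x) :))

set_option hygiene false in
/-- The `(1,0)`-part `a^{1,0} = ½ (a ⊗ 1 - i (a ∘ i) ⊗ 1)` of a real covector `a`. -/
local notation "π₁₀[" a "]" => (2⁻¹ : ℂ) • (ContinuousLinearMap.comp Complex.ofRealCLM a -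
  Complex.I • ContinuousLinearMap.comp Complex.ofRealCLM
    (ContinuousLinearMap.comp a ((Complex.I • ContinuousLinearMap.id ℂ E).restrictScalars ℝ)))

set_option hygiene false in
/-- The chart differential `dρₓ = D(ρ ∘ e⁻¹)(e x)` of a real function at `x`. -/
local notation "dρ[" ρ ", " x "]" => fderivWithin ℝ (ρ ∘ (extChartAt 𝓘(ℝ, E) x).symm)
  (Set.range 𝓘(ℝ, E)) (extChartAt 𝓘(ℝ, E) x x)

set_option hygiene false in
/-- Voisin's operator `P = [∂̄*, L] - i∂` in the edge degree `n - 1`, where the term `∂̄*(Lβ)`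
is absent (`Lβ` would be of degree `n + 1`): `P₁ β = -L(∂̄*β) - i∂β`. -/
local notation "KP₁[" G ", " o ", " h₃ "]" β:max =>
  (-(Lform[G] (dolbeaultBarAdjoint o h₃ β)) - Complex.I • dolbeault β)

/-! ### The symbol: Voisin's Lemma 6.6 in the edge degree -/

section Symbol

variable {V : Type*} [NormedAddCommGroup V] [InnerProductSpace ℝ V] [FiniteDimensional ℝ V]
  {n : ℕ} [Fact (finrank ℝ V = n)] (o : Orientation ℝ V (Fin n))

/-- **Voisin's Lemma 6.6 in symbol form, operator version, edge degree `n - 1`**: with the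
notation and hypotheses of `symbol_dolbeaultBarAdjoint_lefschetz_sub_of`
(`KaehlerSymbolIdentityOpProofs.lean`), if moreover `L₂ β = 0` (which is automatic when `β` has
degree `n - 1`, `L₂ β` being an `(n+1)`-form), then
`L₁ (⋆_ℂ (ξ ∧ ⋆_ℂ β)) - i (ξ ∧ β) = 0` — the symbol of `-L∂̄* - i∂` vanishes in that degree.
Same proof: `⋆_ℂ(ξ ∧ ⋆_ℂ β) = ι_ξ β`, `ι_ξ (L₂ β) = L₁ (ι_ξ β) + (ι_ξ ω) ∧ β` and `ι_ξ ω = -iξ`.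
[cite: Voisin2002, §6.1.1 Lemma 6.6, p. 140] -/
theorem symbol_dolbeaultBarAdjoint_lefschetz_one_of (hn : Even n) (J : V →L[ℝ] V)
    (hJ : ∀ u v, ⟪J u, v⟫ = -⟪u, J v⟫) (ξ : V →L[ℝ] ℂ) (hξ : ∀ v, ξ (J v) = I * ξ v)
    (θ : V →L[ℝ] V →L[ℝ] ℝ) (hθ : ∀ w u, θ w u = 2⁻¹ * ⟪J w, u⟫) {j : ℕ}
    (h₃ : (j + 1) + (0 + 1) = n) (h₄ : (0 + 1 + 1) + j = n)
    (L₂ : V [⋀^Fin (j + 1)]→L[ℝ] ℂ → V [⋀^Fin (j + 1 + 1 + 1)]→L[ℝ] ℂ)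
    (L₁ : V [⋀^Fin j]→L[ℝ] ℂ → V [⋀^Fin (j + 1 + 1)]→L[ℝ] ℂ)
    (hadd : ∀ η η', L₁ (η + η') = L₁ η + L₁ η') (hsmul : ∀ η, L₁ (I • η) = I • L₁ η)
    (hcomm : ∀ (η : V [⋀^Fin (j + 1)]→L[ℝ] ℂ) (w : V),
      (L₂ η).curryLeft w = wedgeOne (θ w - θ.flip w) η + L₁ (η.curryLeft w))
    (β : V [⋀^Fin (j + 1)]→L[ℝ] ℂ) (hβ : L₂ β = 0) :
    L₁ (⋆ℂ[o, h₄] (wedgeOne ξ (⋆ℂ[o, h₃] β))) - I • wedgeOne ξ β = 0 := by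
  have hθ' := eq_half_innerSL_comp_of J θ hθ
  subst hθ'
  have hc := curryLeftC_lefschetz_eq_of _ L₂ L₁ hadd hsmul hcomm β
    ((InnerProductSpace.toDual ℝ V).symm (reCLM.comp ξ))
    ((InnerProductSpace.toDual ℝ V).symm (imCLM.comp ξ))
  rw [hβ, curryLeft_zero, _root_.zero_apply, _root_.zero_apply, smul_zero,
    add_zero, half_innerSL_J_sub_flip J hJ, half_innerSL_J_sub_flip J hJ,
    innerSL_J_dual_re_add J hJ ξ hξ, wedgeOne_neg_left, wedgeOne_smul_left] at hc
  -- hc : 0 = L₁ (ι_ξ β) + -(I • ξ ∧ β)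
  rw [cHodgeStar_wedgeOne_cHodgeStar o h₃ h₄ ξ, neg_one_pow_mul_eq_one_of_even h₃ hn, one_smul,
    sub_eq_add_neg]
  exact hc.symm

end Symbol

/-! ### `P₁` is `C^∞`-linear, local and additive -/

section CinftyLinear

variable {E : Type*} [NormedAddCommGroup E] [NormedSpace ℂ E]
  {M : Type*} [TopologicalSpace M] [ChartedSpace E M] {k : ℕ}
  [FiniteDimensional ℂ E] {n : ℕ} [Fact (finrank ℝ E = n)]
  [RiemannianBundle (fun x : M ↦ TangentSpace 𝓘(ℝ, E) x)]
  (o : (x : M) → Orientation ℝ (TangentSpace 𝓘(ℝ, E) x) (Fin n))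

omit [RiemannianBundle (fun x : M ↦ TangentSpace 𝓘(ℝ, E) x)] in
/-- Forms on a tangent space of degree above the real dimension vanish. [folklore] -/
theorem calt_tangentSpace_eq_zero_of_lt {d : ℕ} (hd : n < d) (x : M)
    (η : TangentSpace 𝓘(ℝ, E) x [⋀^Fin d]→L[ℝ] ℂ) : η = 0 := by
  ext v
  have hV : finrank ℝ (TangentSpace 𝓘(ℝ, E) x) = n := Fact.out
  have hli : ¬ LinearIndependent ℝ v := by
    intro hli
    have := hli.fintype_card_le_finrank
    simp only [Fintype.card_fin, hV] at this
    omega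
  simpa using η.toAlternatingMap.map_linearDependent v hli

/-- **Voisin's Lemma 6.6 at a point of the manifold, edge degree**: for a `(k+1)`-form `β` on
`T_x M` with `(k + 1) + 1 = n` (so that `L β`, of degree `n + 1`, vanishes) and a covector `ξ` of
type `(1,0)`: `L (⋆(ξ ∧ ⋆β)) - i (ξ ∧ β) = 0`. [cite: Voisin2002, §6.1.1 Lemma 6.6, p. 140] -/
theorem symbol_identity_pt_one (x : M) (hn : Even n)
    (hH : ∀ v w : TangentSpace 𝓘(ℝ, E) x, ⟪tangentJ E x v, tangentJ E x w⟫ = ⟪v, w⟫)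
    (G : E →L[ℝ] E →L[ℝ] ℝ) (hG : ∀ v w : TangentSpace 𝓘(ℝ, E) x, G v w = ⟪v, w⟫)
    (ξ : E →L[ℝ] ℂ) (hξ : ∀ v : E, ξ (I • v) = I * ξ v)
    (h₃ : (k + 1) + (0 + 1) = n) (h₄ : (0 + 1 + 1) + k = n) (β : E [⋀^Fin (k + 1)]→L[ℝ] ℂ) :
    @id (TangentSpace 𝓘(ℝ, E) x [⋀^Fin (k + 1 + 1)]→L[ℝ] ℂ)
        (LopE[G] (⋆ℂ[o x, h₄] (wedgeOne (E := TangentSpace 𝓘(ℝ, E) x) ξ (⋆ℂ[o x, h₃] β)))) -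
      I • wedgeOne (E := TangentSpace 𝓘(ℝ, E) x) ξ β = 0 := by
  have hJ : ∀ u v : TangentSpace 𝓘(ℝ, E) x, ⟪tangentJ E x u, v⟫ = -⟪u, tangentJ E x v⟫ := by
    intro u v
    have := hH u (tangentJ E x v)
    rw [tangentJ_tangentJ, inner_neg_right] at this
    linarith
  have hθ : ∀ w u : TangentSpace 𝓘(ℝ, E) x, (θE[G]) w u = 2⁻¹ * ⟪tangentJ E x w, u⟫ := by
    intro w u
    rw [← hG]
    rfl
  have hβ0 : (LopE[G] β : TangentSpace 𝓘(ℝ, E) x [⋀^Fin (k + 1 + 1 + 1)]→L[ℝ] ℂ) = 0 :=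
    calt_tangentSpace_eq_zero_of_lt (n := n) (d := k + 1 + 1 + 1) (by omega) x _
  refine symbol_dolbeaultBarAdjoint_lefschetz_one_of (V := TangentSpace 𝓘(ℝ, E) x) (o x) hn
    (tangentJ E x) hJ ξ (fun v ↦ hξ v) (θE[G]) hθ h₃ h₄
    (fun η ↦ (LopE[G] η :)) (fun η ↦ (LopE[G] η :))
    (fun η η' ↦ lopE_add (E := E) G η η') (fun η ↦ lopE_smul (E := E) G I η) ?_ β hβ0
  intro η w
  have h := curryLeft_lefschetz_eq (θE[G]) η w _ (lfamE_apply G η) _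
    (lfamE_apply G (η.curryLeft w))
  rw [← wedgeOne_tangentSpace x] at h
  exact h

/-- Module algebra behind `P₁(ρβ) = ρ P₁(β)`: if `LB' = ρ LB - LS₂`, `C' = ρ C + W` and
`LS₂ - i W = 0` then `-LB' - i C' = ρ (-LB - i C)`. [folklore] -/
theorem kaehlerP_algebra_one {V : Type*} [AddCommGroup V] [Module ℂ V] [Module ℝ V]
    [SMulCommClass ℂ ℝ V] (r : ℝ) {LB' LB C' C LS₂ W : V} (hB : LB' = r • LB - LS₂)
    (hC : C' = r • C + W) (hS : LS₂ - I • W = 0) : -LB' - I • C' = r • (-LB - I • C) := by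
  subst hB hC
  rw [sub_eq_zero] at hS
  rw [hS, smul_sub, smul_neg, smul_add, smul_comm I r C]
  abel

variable [IsManifold 𝓘(ℝ, E) ∞ M] [IsManifold 𝓘(ℂ, E) ω M]
  [IsContMDiffRiemannianBundle 𝓘(ℝ, E) ∞ E (fun x : M ↦ TangentSpace 𝓘(ℝ, E) x)]

set_option maxHeartbeats 1600000 in
/-- **The operator `P₁ = -L∂̄* - i∂` is `C^∞`-linear** (edge degree): for a smooth `(k+1)`-form
`β` with `(k + 1) + 1 = n` and `ρ` differentiable at `x`, `P₁(ρ β) x = ρ x • P₁(β) x`. The two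
Leibniz rules leave the symbol terms, which cancel by `symbol_identity_pt_one`.
[cite: Voisin2002, §6.1.1 Lemma 6.6] -/
theorem kaehlerP_fun_smul_one
    (hH : ∀ (x : M) (v w : TangentSpace 𝓘(ℝ, E) x), ⟪tangentJ E x v, tangentJ E x w⟫ = ⟪v, w⟫)
    (G : M → E →L[ℝ] E →L[ℝ] ℝ) (hG : ∀ (x : M) (v w : TangentSpace 𝓘(ℝ, E) x), G x v w = ⟪v, w⟫)
    (ho : IsSmoothForm (riemannianVolumeForm o)) (h₃ : (k + 1) + (0 + 1) = n)
    {ρ : M → ℝ} {β : MForm 𝓘(ℝ, E) M ℂ (k + 1)} {x : M}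
    (hρ : MDifferentiableAt 𝓘(ℝ, E) 𝓘(ℝ, ℝ) ρ x) (hβ : IsSmoothForm β) :
    (KP₁[G, o, h₃] (ρ • β)) x = ρ x • (KP₁[G, o, h₃] β) x := by
  have hn : Even n := (Fact.out : finrank ℝ E = n) ▸ even_finrank_real E
  have h₄ : (0 + 1 + 1) + k = n := by omega
  have eB : LopE[G x] (dolbeaultBarAdjoint o h₃ (ρ • β) x) =
      ρ x • LopE[G x] (dolbeaultBarAdjoint o h₃ β x) -
        LopE[G x] (⋆ℂ[o x, h₄] (wedgeOne (E := TangentSpace 𝓘(ℝ, E) x) (π₁₀[dρ[ρ, x]])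
          (⋆ℂ[o x, h₃] (β x)))) := by
    rw [dolbeaultBarAdjoint_fun_smul_apply o ho h₃ h₄ hρ hβ, lopT_sub, lopT_real_smul]
  have eC := eq_add_of_sub_eq' (dolbeault_fun_smul_sub (x := x) hρ hβ)
  rw [← wedgeOne_tangentSpace x] at eC
  have hS := symbol_identity_pt_one o x hn (hH x) (G x) (hG x) (π₁₀[dρ[ρ, x]])
    (π₁₀_I_smul (dρ[ρ, x])) h₃ h₄ (β x)
  rw [Pi.sub_apply, Pi.neg_apply, Pi.smul_apply, Pi.sub_apply, Pi.neg_apply, Pi.smul_apply,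
    lform_apply, lform_apply]
  exact kaehlerP_algebra_one (ρ x) eB eC hS

omit [IsManifold 𝓘(ℝ, E) ∞ M] [IsManifold 𝓘(ℂ, E) ω M]
  [IsContMDiffRiemannianBundle 𝓘(ℝ, E) ∞ E (fun x : M ↦ TangentSpace 𝓘(ℝ, E) x)] in
/-- **Locality of `P₁`**: forms agreeing near `z` have the same `P₁` at `z`. [folklore] -/
theorem kaehlerP_congr_of_eventuallyEq_one (G : M → E →L[ℝ] E →L[ℝ] ℝ)
    (h₃ : (k + 1) + (0 + 1) = n) {α β : MForm 𝓘(ℝ, E) M ℂ (k + 1)}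
    {z : M} (hαβ : ∀ᶠ w in 𝓝 z, α w = β w) :
    (KP₁[G, o, h₃] α) z = (KP₁[G, o, h₃] β) z := by
  rw [Pi.sub_apply, Pi.sub_apply, Pi.smul_apply, Pi.neg_apply, Pi.neg_apply, Pi.smul_apply,
    lform_apply, lform_apply, dolbeaultBarAdjoint_congr_of_eventuallyEq o h₃ hαβ,
    dolbeault_congr_of_eventuallyEq hαβ]

/-- `∂̄* (∑ βᵢ) = ∑ ∂̄* βᵢ` on smooth forms (local copy of `dolbeaultBarAdjoint_sum` of
`KaehlerHodgeAdjointProofs.lean`, to avoid its import closure). [folklore] -/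
private theorem dolbeaultBarAdjoint_sum_aux (ho : IsSmoothForm (riemannianVolumeForm o)) {m : ℕ}
    (h : (k + 1) + m = n) {ι : Type*} (s : Finset ι) (β : ι → MForm 𝓘(ℝ, E) M ℂ (k + 1))
    (hβ : ∀ i ∈ s, IsSmoothForm (β i)) :
    dolbeaultBarAdjoint o h (∑ i ∈ s, β i) = ∑ i ∈ s, dolbeaultBarAdjoint o h (β i) := by
  classical
  induction s using Finset.induction_on with
  | empty => rw [sum_empty, sum_empty, dolbeaultBarAdjoint_zero o h]
  | insert a s ha ih =>
    have hs : ∀ i ∈ s, IsSmoothForm (β i) := fun i hi ↦ hβ i (mem_insert_of_mem hi)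
    have hsum : IsSmoothForm (∑ i ∈ s, β i) :=
      (smoothForms 𝓘(ℝ, E) M ℂ (k + 1)).sum_mem fun i hi ↦ hs i hi
    rw [sum_insert ha, sum_insert ha,
      dolbeaultBarAdjoint_add o ho h (hβ a (mem_insert_self a s)) hsum, ih hs]

/-- **Additivity of `P₁` over finite sums of smooth forms.** [folklore] -/
theorem kaehlerP_sum_one (G : M → E →L[ℝ] E →L[ℝ] ℝ)
    (ho : IsSmoothForm (riemannianVolumeForm o))
    (h₃ : (k + 1) + (0 + 1) = n) {ι : Type*} (s : Finset ι)
    (β : ι → MForm 𝓘(ℝ, E) M ℂ (k + 1)) (hβ : ∀ i ∈ s, IsSmoothForm (β i)) (z : M) :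
    (KP₁[G, o, h₃] (∑ i ∈ s, β i)) z = ∑ i ∈ s, (KP₁[G, o, h₃] (β i)) z := by
  rw [dolbeaultBarAdjoint_sum_aux o ho h₃ s _ hβ, lform_sum, dolbeault_sum s β hβ, smul_sum,
    ← sum_neg_distrib, ← sum_sub_distrib]
  rw [Finset.sum_apply]

/-- **Frame reduction**, edge degree: if `P₁` is `C^∞`-linear at `z` on the smooth forms `Θᵢ`
and `P₁ Θᵢ z = 0`, then `P₁ (∑ ρᵢ • Θᵢ) z = 0`. [cite: Voisin2002, §6.1.1 Prop. 6.5] -/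
theorem kaehlerP_sum_fun_smul_eq_zero_one (G : M → E →L[ℝ] E →L[ℝ] ℝ)
    (ho : IsSmoothForm (riemannianVolumeForm o))
    (h₃ : (k + 1) + (0 + 1) = n) {ι : Type*} (s : Finset ι)
    (Θ : ι → MForm 𝓘(ℝ, E) M ℂ (k + 1)) (hΘ : ∀ i ∈ s, IsSmoothForm (Θ i))
    (ρ : ι → M → ℝ) (hρ : ∀ i ∈ s, ContMDiff 𝓘(ℝ, E) 𝓘(ℝ, ℝ) ∞ (ρ i)) (z : M)
    (hlin : ∀ i ∈ s, (KP₁[G, o, h₃] (ρ i • Θ i)) z = ρ i z • (KP₁[G, o, h₃] (Θ i)) z)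
    (hzero : ∀ i ∈ s, (KP₁[G, o, h₃] (Θ i)) z = 0) :
    (KP₁[G, o, h₃] (∑ i ∈ s, ρ i • Θ i)) z = 0 := by
  have hs : ∀ i ∈ s, IsSmoothForm (ρ i • Θ i) := fun i hi ↦ (hΘ i hi).fun_smul' (hρ i hi)
  rw [kaehlerP_sum_one o G ho h₃ s _ hs z]
  refine Finset.sum_eq_zero fun i hi ↦ ?_
  rw [hlin i hi, hzero i hi, smul_zero]

end CinftyLinear

/-! ### `P₁ Θ = 0` at the centre for the osculating test forms -/

section Exchange

variable {E : Type*} [NormedAddCommGroup E] [NormedSpace ℂ E] [CompleteSpace E]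
  {M : Type*} [TopologicalSpace M] [ChartedSpace E M] [IsManifold 𝓘(ℝ, E) ∞ M]
  (G : M → E →L[ℝ] E →L[ℝ] ℝ) (S : (E →L[ℝ] ℝ) →L[ℝ] E) (B : E →L[ℝ] E →L[ℝ] E) (x₀ : M)
  {k : ℕ}

set_option hygiene false in
/-- The chart at `x₀`. -/
local notation "e₀" => extChartAt 𝓘(ℝ, E) x₀

set_option hygiene false in
/-- Its centre. -/
local notation "c₀" => extChartAt 𝓘(ℝ, E) x₀ x₀

set_option hygiene false in
/-- The derivative of the inverse chart at `y`. -/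
local notation "Sc[" y "]" => tangentCoordChange 𝓘(ℝ, E) x₀
  ((extChartAt 𝓘(ℝ, E) x₀).symm y) ((extChartAt 𝓘(ℝ, E) x₀).symm y)

set_option hygiene false in
/-- The coordinate metric. -/
local notation "Ĝ[" y "]" => ContinuousLinearMap.bilinearComp
  (G ((extChartAt 𝓘(ℝ, E) x₀).symm y)) (Sc[y]) (Sc[y])

set_option hygiene false in
/-- `A y⁻¹`. -/
local notation "Ai[" y "]" => Ring.inverse ((1 : E →L[ℝ] E) + B (y - c₀))

set_option hygiene false in
/-- The Gram operator of the transported metric. -/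
local notation "Q[" y "]" => ContinuousLinearMap.comp S
  (ContinuousLinearMap.bilinearComp (Ĝ[y]) (Ai[y]) (Ai[y]))

set_option hygiene false in
/-- The square root near `1`. -/
local notation "√₁" => HasStrictFDerivAt.localInverse (fun X : E →L[ℝ] E ↦ X * X)
  (ContinuousLinearEquiv.smulLeft (Units.mk0 (2 : ℝ) two_ne_zero) : (E →L[ℝ] E) ≃L[ℝ] (E →L[ℝ] E))
  1 hasStrictFDerivAt_mul_self_one

set_option hygiene false in
/-- The osculating unitary frame `M_f y = √(Q y) ∘ A y`. -/
local notation "Mf[" y "]" => (√₁ (Q[y]) * ((1 : E →L[ℝ] E) + B (y - c₀)))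

set_option hygiene false in
/-- The frame map on the manifold `U_{y'} = M_f (e y') ∘ De_{y'}`. -/
local notation "U[" y' "]" => ContinuousLinearMap.comp (Mf[extChartAt 𝓘(ℝ, E) x₀ y'])
  (mfderiv 𝓘(ℝ, E) 𝓘(ℝ, E) (extChartAt 𝓘(ℝ, E) x₀) y')

set_option hygiene false in
/-- The test form `Θ_{f,η}`. -/
local notation "Θ[" f ", " η "]" =>
  (fun y' : M ↦ (f y' : ℝ) • ContinuousAlternatingMap.compContinuousLinearMap η (U[y']))

variable [FiniteDimensional ℂ E] {n : ℕ} [Fact (finrank ℝ E = n)]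
  [RiemannianBundle (fun x : M ↦ TangentSpace 𝓘(ℝ, E) x)]
  (o : (x : M) → Orientation ℝ (TangentSpace 𝓘(ℝ, E) x) (Fin n))
  [IsManifold 𝓘(ℂ, E) ω M]

set_option maxHeartbeats 800000 in
/-- **`P₁ Θ_{f,η} (x₀) = 0`** in the edge degree: both `∂̄*Θ (x₀)` and `∂Θ (x₀)` vanish
(`dolbeaultBarAdjoint_testForm_apply_eq_zero`, `dolbeault_testForm_apply_eq_zero`).
[cite: Voisin2002, §6.1.1 Prop. 6.5, Lemma 6.6] -/
theorem kaehlerP_testForm_apply_eq_zero_one (h₃ : (k + 1) + (0 + 1) = n) (f : M → ℝ)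
    (hf : ∀ᶠ y' in 𝓝 x₀, f y' = 1) (η : E [⋀^Fin (k + 1)]→L[ℝ] ℂ) (hB : ∀ u v, B u v = B v u)
    (hMd : HasFDerivAt (fun y ↦ Mf[y]) B c₀)
    (hM : ∀ᶠ y' in 𝓝 x₀, Mf[e₀ y'] * ((Complex.I • ContinuousLinearMap.id ℂ E).restrictScalars ℝ) =
      ((Complex.I • ContinuousLinearMap.id ℂ E).restrictScalars ℝ) * Mf[e₀ y'])
    (hor : ∀ᶠ y' in 𝓝 x₀, ∃ φ : TangentSpace 𝓘(ℝ, E) y' ≃ₗᵢ[ℝ] TangentSpace 𝓘(ℝ, E) x₀,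
      (∀ v, φ v = U[y'] v) ∧ o x₀ = Orientation.map (Fin n) φ.toLinearEquiv (o y')) :
    (KP₁[G, o, h₃] Θ[f, η]) x₀ = 0 := by
  have hBB : dolbeaultBarAdjoint o h₃ (Θ[f, η]) x₀ = 0 :=
    dolbeaultBarAdjoint_testForm_apply_eq_zero G S B x₀ o h₃ f hf η hB hMd hM hor
  have hC : dolbeault (Θ[f, η]) x₀ = 0 := dolbeault_testForm_apply_eq_zero G S B x₀ f hf η hB hMd hM
  have hL0 : (Lform[G] (dolbeaultBarAdjoint o h₃ (Θ[f, η]))) x₀ = 0 := by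
    rw [lform_apply, hBB]
    exact lopT_zero x₀ (G x₀)
  rw [Pi.sub_apply, Pi.neg_apply, Pi.smul_apply, hL0, hC, smul_zero, neg_zero, sub_zero]

end Exchange

/-! ### Assembly: `P₁ = 0` on a Kähler manifold -/

section Assembly

variable {E : Type*} [NormedAddCommGroup E] [NormedSpace ℂ E] [FiniteDimensional ℂ E]
  {M : Type*} [TopologicalSpace M] [ChartedSpace E M] [IsManifold 𝓘(ℝ, E) ∞ M]
  [IsManifold 𝓘(ℂ, E) ω M] [T2Space M] {n : ℕ} [Fact (finrank ℝ E = n)]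
  [RiemannianBundle (fun x : M ↦ TangentSpace 𝓘(ℝ, E) x)]
  [IsContMDiffRiemannianBundle 𝓘(ℝ, E) ∞ E (fun x : M ↦ TangentSpace 𝓘(ℝ, E) x)]
  (o : (x : M) → Orientation ℝ (TangentSpace 𝓘(ℝ, E) x) (Fin n))

set_option hygiene false in
/-- The coordinate expression of the metric `G` in the chart at `x₀`, as a function on `E`. -/
local notation "ĜF[" G ", " x₀ "]" => (fun y : E ↦ ContinuousLinearMap.bilinearComp
  (G ((extChartAt 𝓘(ℝ, E) x₀).symm y))
  (tangentCoordChange 𝓘(ℝ, E) x₀ ((extChartAt 𝓘(ℝ, E) x₀).symm y) ((extChartAt 𝓘(ℝ, E) x₀).symm y))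
  (tangentCoordChange 𝓘(ℝ, E) x₀ ((extChartAt 𝓘(ℝ, E) x₀).symm y) ((extChartAt 𝓘(ℝ, E) x₀).symm y)))

set_option maxHeartbeats 1600000 in
/-- **The Kähler identity `[∂̄*, L] = i∂` in the edge degree `n - 1`** (Voisin (2002), Prop. 6.5
with Lemma 6.6; Huybrechts (2005), Prop. 3.1.12): for the alternatization-normalised Lefschetz
operator `Lform[G]` of the Hermitian metric `G x v w = ⟪v, w⟫ₓ` and `∂̄* = -⋆∂⋆`, on a complex
manifold with closed Kähler form, `-L(∂̄*α) - i∂α = 0` for every smooth `(k+1)`-form `α` with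
`(k + 1) + 1 = n` (in that degree the term `∂̄*(Lα)` of `[∂̄*, L]α` is absent, `Lα` being an
`(n+1)`-form). Proof: Voisin's osculation argument, verbatim as in `kaehlerP_apply_eq_zero`
(`KaehlerIdentityAssemblyProofs.lean`) with the edge-degree bricks of this file.
[cite: Voisin2002, §6.1.1 Prop. 6.5] -/
theorem kaehlerP_apply_eq_zero_one (ho : IsSmoothForm (riemannianVolumeForm o))
    (G : M → E →L[ℝ] E →L[ℝ] ℝ) (hG : ∀ (x : M) (v w : TangentSpace 𝓘(ℝ, E) x), G x v w = ⟪v, w⟫)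
    (hH : ∀ x v w, G x (Complex.I • v) (Complex.I • w) = G x v w)
    (hK : IsClosedForm (RiemannianBundle.g (E := fun x : M ↦ TangentSpace 𝓘(ℝ, E) x)).kaehlerForm)
    {k : ℕ} (h₃ : (k + 1) + (0 + 1) = n)
    (α : MForm 𝓘(ℝ, E) M ℂ (k + 1)) (hα : IsSmoothForm α) (x₀ : M) :
    (KP₁[G, o, h₃] α) x₀ = 0 := by
  haveI : CompleteSpace E := FiniteDimensional.complete ℂ E
  -- the complex structure on the model space
  set J : E →L[ℝ] E := (Complex.I • ContinuousLinearMap.id ℂ E).restrictScalars ℝ with hJdef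
  have hJa : ∀ v, J v = Complex.I • v := fun v ↦ rfl
  have hJJ : ∀ v, J (J v) = -v := fun v ↦ by
    rw [hJa, hJa, smul_smul, Complex.I_mul_I, neg_one_smul]
  -- the metric at `x₀`
  have hpos : ∀ a, a ≠ 0 → 0 < G x₀ a a := chartMetric_pos G hG x₀
  have hGs : ∀ x a b, G x a b = G x b a := fun x a b ↦ by rw [hG, hG, real_inner_comm]
  have hsymm : ∀ a b, G x₀ a b = G x₀ b a := hGs x₀
  have hJskew : ∀ a b, G x₀ (J a) b = -G x₀ a (J b) := fun a b ↦ by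
    have h := hH x₀ a (Complex.I • b)
    rw [smul_smul, Complex.I_mul_I, neg_one_smul, map_neg] at h
    rw [hJa, hJa]
    linarith
  have hHJ : ∀ (x : M) (v w : TangentSpace 𝓘(ℝ, E) x), ⟪tangentJ E x v, tangentJ E x w⟫ = ⟪v, w⟫ :=
    fun x v w ↦ by rw [← hG, ← hG, tangentJ_apply, tangentJ_apply, hH]
  obtain ⟨S, hS, -⟩ := exists_riesz (G x₀) hpos
  -- the coordinate metric in the chart at `x₀` and its jet
  have hĜc := chartMetric_apply_c G x₀
  have hĜsymm : ∀ y a b, ĜF[G, x₀] y a b =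
      ĜF[G, x₀] y b a :=
    fun y a b ↦ chartMetric_symm G hGs x₀ y a b
  have hĜs := eventually_contDiffAt_chartMetric G hG x₀
  have hĜcont := hĜs.self_of_nhds.continuousAt
  have hĜJ : ∀ᶠ y in 𝓝 (extChartAt 𝓘(ℝ, E) x₀ x₀), ∀ a b, ĜF[G, x₀] y (J a) (J b) =
      ĜF[G, x₀] y a b := by
    filter_upwards [(isOpen_extChartAt_target (I := 𝓘(ℝ, E)) x₀).mem_nhds
      (mem_extChartAt_target x₀)] with y hy a b
    exact chartMetric_hermitian G hH x₀ hy a b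
  have hD := (hĜs.self_of_nhds.differentiableAt (by simp)).hasFDerivAt
  set D := fderiv ℝ ĜF[G, x₀] (extChartAt 𝓘(ℝ, E) x₀ x₀) with hDdef
  have hDab : ∀ a b, (D.flip a).flip b = fderiv ℝ (fun y ↦ ĜF[G, x₀] y a b) (extChartAt 𝓘(ℝ, E) x₀ x₀) :=
    fun a b ↦ (hasFDerivAt_apply_apply hD a b).fderiv.symm
  have hDsymm : ∀ u a b, D u a b = D u b a := fun u a b ↦ by
    have h := congrArg (fun T : E →L[ℝ] ℝ ↦ T u) ((hDab a b).trans
      ((congrArg (fun F : E → ℝ ↦ fderiv ℝ F (extChartAt 𝓘(ℝ, E) x₀ x₀))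
        (funext fun y ↦ hĜsymm y a b)).trans (hDab b a).symm))
    simpa only [ContinuousLinearMap.flip_apply] using h
  have hDJ : ∀ u a b, D u (J a) (J b) = D u a b := fun u a b ↦ by
    have hev : (fun y ↦ ĜF[G, x₀] y (J a) (J b)) =ᶠ[𝓝 (extChartAt 𝓘(ℝ, E) x₀ x₀)]
        (fun y ↦ ĜF[G, x₀] y a b) :=
      hĜJ.mono fun y hy ↦ hy a b
    have h := congrArg (fun T : E →L[ℝ] ℝ ↦ T u) ((hDab (J a) (J b)).trans
      (hev.fderiv_eq.trans (hDab a b).symm))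
    simpa only [ContinuousLinearMap.flip_apply] using h
  have hKjet : ∀ u v w, D u (J v) w - D v (J u) w + D w (J u) v = 0 := fun u v w ↦
    chartMetric_kaehler_jet G hG hH hK x₀ hD u v w
  -- the Koszul map
  obtain ⟨B, hB⟩ := exists_koszul (G x₀) S hS D
  have hBsymm : ∀ u v, B u v = B v u := fun u v ↦ koszul_symm' hpos hDsymm hB u v
  have hBg : ∀ u v w, D u v w = G x₀ (B u v) w + G x₀ v (B u w) := fun u v w ↦
    koszul_metric' hsymm hDsymm hB u v w
  have hBJ : ∀ u v, B u (J v) = J (B u v) := fun u v ↦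
    koszul_J' hpos J hJJ hJskew hDsymm hDJ hKjet hB u v
  -- the osculating unitary frame
  have hiso := eventually_frameM_isometry (G x₀) S B ĜF[G, x₀] (extChartAt 𝓘(ℝ, E) x₀ x₀) hpos hsymm hS hĜc hĜcont hĜsymm
  have hMd := hasFDerivAt_frameM (G x₀) S B ĜF[G, x₀] (extChartAt 𝓘(ℝ, E) x₀ x₀) hpos hsymm hS hĜc hĜs hĜsymm hD hBg
  have hMs := eventually_contDiffAt_frameM (G x₀) S B ĜF[G, x₀] (extChartAt 𝓘(ℝ, E) x₀ x₀) hpos hS hĜc hĜs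
  have hunit := eventually_isUnit_frameM (G x₀) S B ĜF[G, x₀] (extChartAt 𝓘(ℝ, E) x₀ x₀) hpos hS hĜc hĜcont
  have hcomm := eventually_frameM_comm (G x₀) S B ĜF[G, x₀] (extChartAt 𝓘(ℝ, E) x₀ x₀) hpos hS hĜc hĜcont J hJJ hJskew hĜJ hBJ
  have hM1 := frameM_apply_c (G x₀) S B ĜF[G, x₀] (extChartAt 𝓘(ℝ, E) x₀ x₀) hpos hS hĜc
  -- transport to `M`
  have hT := continuousAt_extChartAt (I := 𝓘(ℝ, E)) x₀
  have hiso' := hT.eventually hiso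
  have hcomm' := hT.eventually hcomm
  have hunit' := hT.eventually hunit
  have hMs' := hT.eventually hMs
  have hor' := eventually_orientation_testFrame G S B x₀ o hG ho hiso hMs.self_of_nhds hM1
  -- a bump function supported where the frame is invertible and smooth
  obtain ⟨f, -, hf⟩ := (SmoothBumpFunction.nhds_basis_tsupport (I := 𝓘(ℝ, E)) x₀).mem_iff.1
    (hunit'.and hMs')
  have hfu : ∀ z ∈ tsupport f, _ := fun z hz ↦ (hf hz).1
  have hfs : ∀ z ∈ tsupport f, _ := fun z hz ↦ (hf hz).2
  have hf1 : ∀ᶠ y' in 𝓝 x₀, f y' = 1 := f.eventuallyEq_one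
  -- expansion of `α` in test forms
  obtain ⟨N, ε, ρ, hρ, hexp⟩ := exists_expansion_testForms G S B x₀ α hα f hfu hfs
  rw [kaehlerP_congr_of_eventuallyEq_one o G h₃ hexp]
  refine kaehlerP_sum_fun_smul_eq_zero_one o G ho h₃ Finset.univ _ (fun i _ ↦ ?_) ρ
    (fun i _ ↦ hρ i) x₀ (fun i _ ↦ ?_) (fun i _ ↦ ?_)
  · exact isSmoothForm_testForm G S B x₀ f (ε i) hfs
  · exact kaehlerP_fun_smul_one o hHJ G hG ho h₃
      ((hρ i).contMDiffAt.mdifferentiableAt (by simp))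
      (isSmoothForm_testForm G S B x₀ f (ε i) hfs)
  · exact kaehlerP_testForm_apply_eq_zero_one G S B x₀ o h₃ f hf1 (ε i) hBsymm hMd hcomm' hor'

end Assembly

end Literature.NumberTheory.Transcendental
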